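import Summits.BirchSwinnertonDyer.Rank1Residual.GaloisImage.KatoZetaValueDerivativeCongruence
import Summits.BirchSwinnertonDyer.Rank1Residual.GaloisImage.KatoZetaValueCharacterSums
import Summits.BirchSwinnertonDyer.Rank1Residual.GaloisImage.CyclotomicTameLevelArithmetic
import Summits.BirchSwinnertonDyer.Rank1Residual.GaloisImage.CyclotomicUnitsCRTCoordinates
import Literature.NumberTheory.EllipticCurves.KuriharaNumber
import Literature.NumberTheory.EllipticCurves.EichlerShimuraConstructionProofs
import HarnessLib

/-!
# The derivative congruence for Kato's zeta value `x_{0,r}` from `ZetaBody` (PK-4b-C's OUT at the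
# tame level `n = cycLevel p 0 r`, in the place-indexed currency of THEOREM D / T-PK6-GEN)
# (cell `b2b-bsdres`, team n1011, ROUTE-1 PORT anatomy (P-KIM); R1-71/R1-72: PK-4b
# `KatoZetaValueDerivativeCongruence`, layer PK-4b-C4b-2 (v); seat p15 GEN 10)

HONEST FRAMING (cell `b2b-bsdres`, run/shared/lean/b2b/bsd-rank1-residual/, verbatim in every
file): the goal of the cell is to DELETE the COMBINATION-SHAPED residual classes of the
Birch–Swinnerton-Dyer formula for ALL analytic-rank `≤ 1` elliptic curves over `ℚ` — "full BSD
formula for every rank `≤ 1` curve in class `C`" assembled STRICTLY from published theorems — so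
that the rank-`≤ 1` remainder becomes exactly the CONSTRUCTION-SHAPED classes, which are TYPED
(missing-input `Prop`s), NOT attempted. This is not "finishing BSD". Team n1011 (N10/N11; ROUTE 1,
the PORT anatomy (P-KIM) of class X4 ∧ `p = 3`): research route on CONSTRUCTION-SHAPED classes;
prove what is provable now; no claim beyond stated classes; census output = EVIDENCE, never a
Literature fact; RESIDUAL-MAP marks UNCHANGED; nothing is booked by this file. TOOL THEOREMS ONLY:
no definition, no named fact, no instance, no `sorry`; the Kato fact `ZetaBody` enters as the
displayed HYPOTHESIS `hbody` (witnesses bound, never obtained), the `p`-integral structures `Θ`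
(PK-3's `hΘ` verbatim) and `V` (the twist) are DISPLAYED.

## What

★★ `prod_deriv_mul_plusAvatar_sub_mem_map_span_of_zetaBody`: the congruence
`KatoZetaValueDerivativeCongruence.prod_deriv_mul_plusAvatar_sub_mem_map_span` at Kato's tame level
`n = cycLevel p 0 r` (`r` a finite set of usable places of `cyclotomicLevelsRat p (badPlaces c d A N)`,
`ℓ_q` their primes, depletion modulus `p·A`), with every input the tree can supply DISCHARGED:
the value law `hval` by PK-4a `ZetaValueCharSum.charSum_eq_of_even` from `hbody : ZetaBody …` and the
rationality of `κ` (`hκ : (uκ : ℝ) = κ`, ROUTE-1 §53.5 R-κ (b)); the `p`-integrality of the symbols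
`[t/m]⁺_f`, `m ∣ n`, by `IsNewformOf.norm_ratPlusSymbol_div_le_one` (`p` odd, `E[p]` irreducible);
`ℓ_q ∤ N`, `(p·A, n) = 1` from `ℓ_q ∤ 2cdpAN`; `a_{ℓ_q}(f) ∈ ℤ` by
`IsNewform0.exists_intCast_eq_cuspCoeff`; the lifts `λ_q ↦ ℓ_q` chosen inside; the derivative units
`b_q` are asked to be `≡ 1` modulo every OTHER prime of `n` (T-PK6-VAL FILE 3's `hoff` currency,
`UnitsCRT.units_eq_of_forall_unitsMap_eq` turns it into `b_q ∈ ker((ℤ/n)ˣ → (ℤ/(n/ℓ_q))ˣ)`).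
Conclusion, indexed by the places `q ∈ r` (`∏ q ∈ r`, lengths `ℓ_q − 1`):
`(∏_{q∈r} Σ_{j<ℓ_q−1} j δ_{b_q^j}) · ((n • (1 + δ₋₁)X)^{ℚ_p} − (Θ·V)^{ℚ_p}) ∈ image of p^K ℤ_p[(ℤ/n)ˣ]` —
the `hmem` of T-PK6-VAL ★★ `GroupRingEval.exists_mem_cycIntLattice_symm_deriv_sub_tmul_eq_pow_smul_of_mem_map_span`
(`c₀ = n`, `d = r`, `N_q = ℓ_q − 1`, its `Θ` := `Θ·V`).  STILL DISPLAYED (by design): the avatar `X` of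
`x_{0,r}` (T-PKEV E-D `exists_unique_eq_sum_coeff_smul_sigma_zeta`), the embedding unit `u`, `Θ`
(PK-3), `V` with the explicit twist `(1 + δ₋₁)·uκ δ_{u⁻¹}·E·C⁻` it lifts (its `p`-integrality = the
row's depletion / 𝔊⁻ certificates), the units `[q]`, `[c]`, `[d]` mod `n`, `a_q ∈ ℤ` for `q ∣ pA`,
`p ≠ 2`, `p^K ∣ ℓ_q − 1`.  HONEST LIMITS: closes nothing; books nothing; no `hval` of PK-5 assembled
here (T-PK6-VAL / T-PK6-GEN do that).

References: K. Kato, Astérisque 295 (2004) Thm. 6.6 (1) p. 163, §6.2 p. 161, Thm. 9.7 p. 189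
[Kato2004Asterisque]; C.-H. Kim, AJM 148 (2026) = arXiv:2203.12159, proof of Thm. 3.13
[Kim2022StructureSelmer]; K. Rubin, *Euler Systems* (2000) §4.4, §9.6 [Rubin2000]; r1 ROUTE-1 §55–57
R1-71/R1-72 (cells/n1011/ROUTE-1.md); `HOME/b2b-bsdres-n1011-p15/g9/pk4/PK4b-C4-DESIGN.md`.
-/

noncomputable section

open scoped NumberField BigOperators TensorProduct
open IsDedekindDomain NumberField WeierstrassCurve CongruenceSubgroup Finset MonoidAlgebra

namespace Summit.BirchSwinnertonDyer.Rank1Residual.GaloisImage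

namespace EulerFactorComparison

open Literature.NumberTheory.GaloisRepresentations Literature.NumberTheory.EllipticCurves
  Literature.NumberTheory.EllipticCurves.ModularForms
  Literature.NumberTheory.EllipticCurves.Kato2004
  Literature.NumberTheory.EllipticCurves.Kato2004.EulerSystemValues Rat.HeightOneSpectrum

variable {W : WeierstrassCurve ℚ} [W.IsElliptic] [W.IsGloballyMinimal] {p : ℕ} [Fact p.Prime]
  [ContinuousSMul ℤ_[p] (W.tateModule p)] [Module.Free ℤ_[p] (W.tateModule p)]
  [Module.Finite ℤ_[p] (W.tateModule p)] {N : ℕ} [NeZero N] {f : CuspForm (Gamma0 N) 2}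
  {ι : (m : ℕ) → (CyclotomicField m ℚ →+* ℂ)} {κ : ℝ}
  {Λ : ∀ (k : ℕ) (r : Finset (HeightOneSpectrum (𝓞 ℚ))),
    H1 (tateRep W p) (cycSubgroup p k r) →ₗ[ℤ_[p]] ℚ_[p] ⊗[ℚ] CyclotomicField (cycLevel p k r) ℚ}
  {c d a : ℤ} {A : ℕ} [NeZero A]
  {z : ∀ (k : ℕ) (r : (cyclotomicLevelsRat p (badPlaces c d A N)).Ideals),
    H1 (tateRep W p) ((cyclotomicLevelsRat p (badPlaces c d A N)).level k r.1)}
  {x : ∀ (k : ℕ) (r : (cyclotomicLevelsRat p (badPlaces c d A N)).Ideals),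
    CyclotomicField (cycLevel p k r.1) ℚ}

set_option backward.isDefEq.respectTransparency false in
/-- **★★ PK-4b-C's OUT from `ZetaBody`, at the tame level `n = cycLevel p 0 r`, place-indexed.**
See the module docstring: the congruence `prod_deriv_mul_plusAvatar_sub_mem_map_span` with `hval`,
`hint`, `ℓ_q ∤ N`, `(pA, n) = 1`, `a_{ℓ_q} ∈ ℤ`, the lifts `λ_q` DISCHARGED from `hbody`, `hf`, `hp2`,
`hirr` and the level; displayed: `X` (avatar), `u` (embedding), `uκ` (rational `κ`), the twist data,
`b_q ≡ 1` off `ℓ_q`, `p^K ∣ ℓ_q − 1`, `Θ` (PK-3's `hΘ`), `V` (`hV`). Output = T-PK6-VAL's `hmem` with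
`c₀ = n`, `d = r`, `N_q = ℓ_q − 1`, `Θ := Θ·V`.
[cite: Kato2004Asterisque, Thm. 6.6 (1) (p. 163), §6.2 (p. 161) and Thm. 9.7 (p. 189)]
[cite: Kim2022StructureSelmer, the proof of Thm. 3.13 (arXiv v3 pp. 26–28; = Thm. 3.11 of AJM 148)] -/
theorem prod_deriv_mul_plusAvatar_sub_mem_map_span_of_zetaBody
    (hbody : ZetaBody W p f ι κ Λ c d a A z x) (hf : IsNewformOf W f) (hp2 : p ≠ 2)
    (hirr : W.HasIrreducibleModPGaloisRep p)
    (r : (cyclotomicLevelsRat p (badPlaces c d A N)).Ideals) (d' : ℤ)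
    (hcd : Int.gcd (c * d) (cycLevel p 0 r.1 * A) = 1) (hdd' : d * d' ≡ 1 [ZMOD (A : ℤ)])
    (uκ : ℚ) (hκ : (uκ : ℝ) = κ)
    (u : (ZMod (cycLevel p 0 r.1))ˣ)
    (hι : ι (cycLevel p 0 r.1) (IsCyclotomicExtension.zeta (cycLevel p 0 r.1) ℚ
        (CyclotomicField (cycLevel p 0 r.1) ℚ)) =
      Complex.exp (2 * Real.pi * Complex.I * ((u : ZMod (cycLevel p 0 r.1)).val : ℂ) / (cycLevel p 0 r.1)))
    (X : MonoidAlgebra ℚ (ZMod (cycLevel p 0 r.1))ˣ)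
    (hxX : x 0 r = ∑ g : (ZMod (cycLevel p 0 r.1))ˣ, X.coeff g •
      sigma (cycLevel p 0 r.1) g (IsCyclotomicExtension.zeta (cycLevel p 0 r.1) ℚ
        (CyclotomicField (cycLevel p 0 r.1) ℚ)))
    (b : HeightOneSpectrum (𝓞 ℚ) → (ZMod (cycLevel p 0 r.1))ˣ)
    (hb : ∀ q ∈ r.1, ∀ ℓ' (hℓ' : ℓ' ∈ (cycLevel p 0 r.1).primeFactors),
      ℓ' ≠ ((primesEquiv q : Nat.Primes) : ℕ) → ZMod.unitsMap (Nat.dvd_of_mem_primeFactors hℓ') (b q) = 1)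
    (uq : ℕ → (ZMod (cycLevel p 0 r.1))ˣ)
    (huq : ∀ q ∈ (p * A).primeFactors, ((uq q : (ZMod (cycLevel p 0 r.1))ˣ) : ZMod (cycLevel p 0 r.1)) = q)
    (aM : ℕ → ℤ) (haM : ∀ q ∈ (p * A).primeFactors, cuspCoeff f q = aM q)
    (Eq : MonoidAlgebra ℚ (ZMod (cycLevel p 0 r.1))ˣ)
    (hEq : Eq = ∏ q ∈ (p * A).primeFactors, (1 - single (uq q)⁻¹ ((aM q : ℚ) / q) +
      single ((uq q)⁻¹ ^ 2) (if q ∣ N then 0 else (1 / q : ℚ))))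
    (uc ud : (ZMod (cycLevel p 0 r.1))ˣ) (huc : (uc : ZMod (cycLevel p 0 r.1)) = c)
    (hud : (ud : ZMod (cycLevel p 0 r.1)) = d)
    (Cq : MonoidAlgebra ℚ (ZMod (cycLevel p 0 r.1))ˣ)
    (hCq : Cq = algebraMap ℚ _ ((c : ℚ) ^ 2 * (d : ℚ) ^ 2 * ratMinusSymbol f ((a : ℚ) / A)) -
      single uc ((c : ℚ) * (d : ℚ) ^ 2 * ratMinusSymbol f ((a * c : ℚ) / A)) -
      single ud ((c : ℚ) ^ 2 * (d : ℚ) * ratMinusSymbol f ((a * d' : ℚ) / A)) +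
      single (uc * ud) ((c : ℚ) * (d : ℚ) * ratMinusSymbol f ((a * c * d' : ℚ) / A)))
    (Vq : MonoidAlgebra ℚ (ZMod (cycLevel p 0 r.1))ˣ)
    (hVq : Vq = (1 + single (-1 : (ZMod (cycLevel p 0 r.1))ˣ) (1 : ℚ)) * single u⁻¹ uκ * Eq * Cq)
    (K : ℕ) (hK : ∀ q ∈ r.1, p ^ K ∣ ((primesEquiv q : Nat.Primes) : ℕ) - 1)
    (Θ : MonoidAlgebra ℤ_[p] (ZMod (cycLevel p 0 r.1))ˣ)
    (hΘ : ∀ g : (ZMod (cycLevel p 0 r.1))ˣ, ((Θ.coeff g : ℤ_[p]) : ℚ_[p]) =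
      ((ratPlusSymbol f (((g : ZMod (cycLevel p 0 r.1)).val : ℚ) / (cycLevel p 0 r.1)) : ℚ) : ℚ_[p]))
    (V : MonoidAlgebra ℤ_[p] (ZMod (cycLevel p 0 r.1))ˣ)
    (hV : MonoidAlgebra.mapRingHom (ZMod (cycLevel p 0 r.1))ˣ (PadicInt.Coe.ringHom (p := p)) V =
      MonoidAlgebra.mapRingHom (ZMod (cycLevel p 0 r.1))ˣ (algebraMap ℚ ℚ_[p]) Vq) :
    (∏ q ∈ r.1, ∑ j : Fin (((primesEquiv q : Nat.Primes) : ℕ) - 1),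
        MonoidAlgebra.single (b q ^ (j : ℕ)) ((j : ℕ) : ℚ_[p])) *
        (MonoidAlgebra.mapRingHom (ZMod (cycLevel p 0 r.1))ˣ (algebraMap ℚ ℚ_[p])
            ((cycLevel p 0 r.1 : ℚ) • ((1 + MonoidAlgebra.single (-1 : (ZMod (cycLevel p 0 r.1))ˣ) (1 : ℚ)) * X)) -
          MonoidAlgebra.mapRingHom (ZMod (cycLevel p 0 r.1))ˣ (PadicInt.Coe.ringHom (p := p)) (Θ * V)) ∈
      (Ideal.span {((p : MonoidAlgebra ℤ_[p] (ZMod (cycLevel p 0 r.1))ˣ)) ^ K}).toAddSubmonoid.map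
        (MonoidAlgebra.mapRingHom (ZMod (cycLevel p 0 r.1))ˣ (PadicInt.Coe.ringHom (p := p)) :
          MonoidAlgebra ℤ_[p] (ZMod (cycLevel p 0 r.1))ˣ →+ MonoidAlgebra ℚ_[p] (ZMod (cycLevel p 0 r.1))ˣ) := by
  classical
  -- the enumeration of the primes of the level `n = cycLevel p 0 r` by the places of `r`
  let ℓ : ↥r.1 → ℕ := fun i => ((primesEquiv (i : HeightOneSpectrum (𝓞 ℚ)) : Nat.Primes) : ℕ)
  haveI hℓ : ∀ i, Fact (ℓ i).Prime := fun i => ⟨(primesEquiv (i : HeightOneSpectrum (𝓞 ℚ))).2⟩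
  have hinj : Function.Injective ℓ := fun i j h =>
    Subtype.ext (primesEquiv.injective (Subtype.ext h))
  have hn : ∏ i, ℓ i = cycLevel p 0 r.1 := by
    rw [TameLevel.cycLevel_zero_eq_prod, ← Finset.prod_coe_sort r.1]
  have hsq : Squarefree (cycLevel p 0 r.1) := TameLevel.squarefree_cycLevel_zero p r.1
  -- the usable places avoid `2cdpAN`
  have hprim : ∀ i : ↥r.1, ¬ ℓ i ∣ 2 * c.natAbs * d.natAbs * A * N ∧ ℓ i ≠ p := fun i =>
    (mem_primes_cyclotomicLevelsRat_badPlaces_iff p c d A N i.1).mp (r.2 i.1 i.2)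
  have hℓN : ∀ i, ¬ ℓ i ∣ N := fun i h => (hprim i).1 (dvd_mul_of_dvd_right h _)
  have hℓA : ∀ i, ¬ ℓ i ∣ A := fun i h =>
    (hprim i).1 (dvd_mul_of_dvd_left (dvd_mul_of_dvd_right h _) _)
  have hM0 : p * A ≠ 0 := mul_ne_zero (Fact.out : p.Prime).ne_zero (NeZero.ne A)
  have hM : (p * A).Coprime (cycLevel p 0 r.1) := by
    rw [← hn]
    refine Nat.Coprime.prod_right fun i _ => Nat.Coprime.mul_left ?_ ?_
    · exact (Nat.coprime_primes Fact.out (hℓ i).out).mpr (hprim i).2.symm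
    · exact ((Nat.Prime.coprime_iff_not_dvd (hℓ i).out).mpr (hℓA i)).symm
  have hnN : (cycLevel p 0 r.1).Coprime N := by
    rw [← hn]
    exact Nat.Coprime.prod_left fun i _ => (Nat.Prime.coprime_iff_not_dvd (hℓ i).out).mpr (hℓN i)
  -- integrality of the Hecke eigenvalues and of the plus symbols
  have hQ := hf.coeffField_eq_bot
  choose aℓ ha using fun i : ↥r.1 => hf.1.exists_intCast_eq_cuspCoeff hQ (ℓ i)
  have hint : ∀ m : ℕ, m ∣ cycLevel p 0 r.1 → ∀ t : ℕ, ‖((ratPlusSymbol f ((t : ℚ) / m) : ℚ) : ℚ_[p])‖ ≤ 1 := by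
    intro m hm t
    have h := hf.norm_ratPlusSymbol_div_le_one hp2 hirr (Nat.Coprime.coprime_dvd_left hm hnN) (t : ℤ)
    rwa [Int.cast_natCast] at h
  -- the lifts `λ_i ↦ ℓ_i mod n/ℓ_i`
  have hlamex : ∀ i : ↥r.1, ∃ lam : (ZMod (cycLevel p 0 r.1))ˣ,
      ((ZMod.unitsMap (prod_dvd_of_prod_eq ℓ hn (univ.erase i)) lam : (ZMod (∏ j ∈ univ.erase i, ℓ j))ˣ) :
        ZMod (∏ j ∈ univ.erase i, ℓ j)) = (ℓ i : ZMod (∏ j ∈ univ.erase i, ℓ j)) := by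
    intro i
    have hcop : (ℓ i).Coprime (∏ j ∈ univ.erase i, ℓ j) :=
      (Nat.Prime.coprime_iff_not_dvd (hℓ i).out).mpr fun h =>
        ((dvd_prod_erase_iff_not_dvd ℓ hinj hn (hn ▸ Finset.dvd_prod_of_mem ℓ (Finset.mem_univ i)) i).mp h)
          (dvd_refl _)
    obtain ⟨lam, hlam⟩ := ZMod.unitsMap_surjective (prod_dvd_of_prod_eq ℓ hn (univ.erase i))
      (ZMod.unitOfCoprime (ℓ i) hcop)
    exact ⟨lam, by rw [hlam, ZMod.coe_unitOfCoprime]⟩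
  choose lam hlam using hlamex
  -- the derivative units lie in the inertia factors (CRT, T-PK6-VAL FILE 3)
  have hb' : ∀ i : ↥r.1, b i.1 ∈ (ZMod.unitsMap (prod_dvd_of_prod_eq ℓ hn (univ.erase i))).ker := by
    intro i
    haveI : NeZero (∏ j ∈ univ.erase i, ℓ j) := ⟨Finset.prod_ne_zero_iff.mpr fun j _ => (hℓ j).out.ne_zero⟩
    rw [MonoidHom.mem_ker]
    refine UnitsCRT.units_eq_of_forall_unitsMap_eq _
      (hsq.squarefree_of_dvd (prod_dvd_of_prod_eq ℓ hn (univ.erase i))) _ _ fun ℓ' hℓ' => ?_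
    rw [map_one, ← MonoidHom.comp_apply, ZMod.unitsMap_comp]
    have hℓ'n : ℓ' ∈ (cycLevel p 0 r.1).primeFactors :=
      Nat.primeFactors_mono (prod_dvd_of_prod_eq ℓ hn (univ.erase i)) (NeZero.ne _) hℓ'
    refine hb i.1 i.2 ℓ' hℓ'n fun h => ?_
    have hdvd : ℓ i ∣ ∏ j ∈ univ.erase i, ℓ j := by
      have := Nat.dvd_of_mem_primeFactors hℓ'; rwa [h] at this
    exact ((dvd_prod_erase_iff_not_dvd ℓ hinj hn (hn ▸ Finset.dvd_prod_of_mem ℓ (Finset.mem_univ i)) i).mp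
      hdvd) (dvd_refl _)
  -- the value law (PK-4a) with rational `κ`
  have hκ' : (κ : ℂ) = ((uκ : ℚ) : ℂ) := by rw [← hκ, Complex.ofReal_ratCast]
  have hval : ∀ {n₀ : ℕ} [NeZero n₀] (hn₀ : n₀ ∣ cycLevel p 0 r.1) {χ₀ : DirichletCharacter ℂ n₀},
      χ₀.IsPrimitive → χ₀ (-1) = 1 →
      charSum (cycLevel p 0 r.1) (ι (cycLevel p 0 r.1)) (DirichletCharacter.changeLevel hn₀ χ₀) (x 0 r) =
        ((uκ : ℚ) : ℂ) * ((∏ q ∈ (cycLevel p 0 r.1 * (p * A)).primeFactors.filter (fun q => ¬ q ∣ n₀),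
            (1 - χ₀ (q : ZMod n₀) * cuspCoeff f q * (q : ℂ) ^ (-(1 : ℂ)) +
              (if q ∣ N then 0 else (q : ℂ)) * χ₀ (q : ZMod n₀) ^ 2 * ((q : ℂ) ^ (-(1 : ℂ))) ^ 2)) *
          ((∑ b : ZMod n₀, χ₀⁻¹ b * ((ratPlusSymbol f ((b.val : ℚ) / n₀) : ℚ) : ℂ)) /
            gaussSum χ₀⁻¹ (ZMod.stdAddChar (N := n₀)))) *
        cuspFactor f true (fun j => (DirichletCharacter.changeLevel hn₀ χ₀)⁻¹ (j : ZMod (cycLevel p 0 r.1)))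
          c d a A d' := by
    intro n₀ _ hn₀ χ₀ hχ₀ heven
    rw [← hκ']
    exact ZetaValueCharSum.charSum_eq_of_even W p f ι κ Λ c d a A z x hbody hf.1 hQ 0 r d' hcd hdd' hn₀ hχ₀ heven
  -- the generic congruence at the enumeration `ℓ`
  have h := prod_deriv_mul_plusAvatar_sub_mem_map_span ℓ hinj hn f hf.1 hQ hℓN aℓ ha (x 0 r) X hxX
    (ι (cycLevel p 0 r.1)) u hι
    uκ hM0 hM c d a A d' hval lam hlam (fun i => b i.1) hb'
    (fun i => ∑ h ∈ univ.filter (· ∈ (ZMod.unitsMap (prod_dvd_of_prod_eq ℓ hn (univ.erase i))).ker),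
      single h (1 : ℚ))
    (fun i => ∑ j ∈ range (ℓ i - 1), single (b i.1 ^ j) ((j : ℕ) : ℚ))
    (fun i => algebraMap ℚ _ (((ℓ i : ℚ) - 2) / 2))
    (fun i => algebraMap ℚ _ (aℓ i : ℚ) - single (lam i)⁻¹ (1 : ℚ) - single (lam i) (ℓ i : ℚ))
    (fun i => algebraMap ℚ _ (aℓ i : ℚ) - single (lam i) (1 : ℚ) - single (lam i)⁻¹ (1 : ℚ))
    (fun _ => rfl) (fun _ => rfl) (fun _ => rfl) (fun _ => rfl) (fun _ => rfl)
    uq huq aM haM Eq hEq uc ud huc hud Cq hCq Vq hVq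
    (fun e => ∑ g : (ZMod (cycLevel p 0 r.1))ˣ, single g (ratPlusSymbol f
      ((((ZMod.unitsMap (prod_dvd_of_prod_eq ℓ hn e) g : (ZMod (∏ i ∈ e, ℓ i))ˣ) :
        ZMod (∏ i ∈ e, ℓ i)).val : ℚ) / (∏ i ∈ e, ℓ i : ℕ))))
    (fun _ => rfl) p hp2 K (fun i => hK i.1 i.2) hint Θ hΘ V hV
  rw [← Finset.prod_coe_sort r.1]
  exact h

end EulerFactorComparison

end Summit.BirchSwinnertonDyer.Rank1Residual.GaloisImage

end
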